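import Summits.QuantumFields.BalabanUV.T4Continuum.Support.InsertionLinearRate
import Summits.QuantumFields.BalabanUV.T4Continuum.Support.StepRecursion

/-!
# NE5 ∕ U3, route P2 — MI-R BY CONSTRUCTION for the LINEAR insertion class: both runs' blindness ⟹ `RepresentsA (recA M) ∧
# RepresentsB (recB M)` (the §MI-R addendum of `InsertionLinearRate` v1.1, p207672 — stuck in the append-only lane since
# 2026-08-20T05:44Z — re-filed as its own module so that consumers can import it)

Cell `pub-balaban`, unit `b2b-balaban-t4-ne5-p2` (T⁴ fan-out NE5 ∕ node U3, PROVER seat P2 «polymer-activity Lipschitz ∕ Kotecký–Preiss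
route», lineage gen 18; content = gen 17's v1.1 addendum, XREAD C-ne5leaf09-1 INFO-2∕(d) folded).  Summits-side new work under the LEAN
PLACEMENT RULE (cell bookkeeping; NOT a Literature module; nothing of the manuscripts under audit is asserted).  HONEST FRAMING: rung (B)+1 of
the FINITE-VOLUME T⁴ continuum programme — NOT infinite volume, NOT a mass gap, NOT the Clay problem, NOT a proof of NE5 (spine 0∕9).
HONEST DEPENDENCY (cell line, verbatim): continuum YM on T⁴ ⇐ BetaPertH ∧ nine spine estimates (0/9 proved); BetaPertH ⇐ (D1) ∧ (D4) ∧
CAP+tail; G-an2-4 gates asym, D1 and NE2/3/4.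

WHAT.  `insBlindB_of_readsB` — run B's `StepRecursion.InsBlindB` BY CONSTRUCTION for a step model whose run-B insertion is read from a
`LinearInsertion` (the twin of `InsertionLinearClass.insBlind_of_reads`); `represents_rec_of_linear` — MI-R (leaves L01 ∧ L02) BY
CONSTRUCTION for the linear class: both insertions linear + run A's data read at the transported background (`StepRecursion.ReadsTransported`)
⟹ `RepresentsA (recA M) W ∧ RepresentsB (recB M) W` (via `StepRecursion.representsA_recA` ∕ `representsB_recB`).  No estimate.  0 sorry;
axioms ⊆ {propext, Classical.choice, Quot.sound}.  (If p207672 later lands, its §MI-R declarations are the same statements under the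
namespace `InsertionLinearRate`; this module is then a harmless twin.)
-/

open scoped BigOperators

namespace Summit.QuantumFields.BalabanUV.T4Continuum.InsertionLinearRateMIR

open Literature.MathematicalPhysics.QuantumFieldTheory.Balaban1983to89.T4OutputRate (Carriers)
open Literature.MathematicalPhysics.QuantumFieldTheory.Balaban1983to89.T4InputCauchyRateData (StepModel)
open Summit.QuantumFields.BalabanUV.T4Continuum.InsertionLinearClass (LinearInsertion)
open Summit.QuantumFields.BalabanUV.T4Continuum.InsertionLinearRate (LinearPair.ReadsB)
open Summit.QuantumFields.BalabanUV.T4Continuum.StepRecursion (InsBlindB ReadsTransported recA recB representsA_recA representsB_recB)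

variable {C : Carriers} {Op Hist : Type*} [NormedAddCommGroup Op] [NormedSpace ℂ Op] [NormedAddCommGroup Hist]
  [NormedSpace ℂ Hist] {LA LB : LinearInsertion C Hist} {M : StepModel C Op Hist} {W : Set (ℕ → ℝ)}

/-- [folklore] **Run B's `InsBlindB` BY CONSTRUCTION** for the linear class (the twin of `InsertionLinearClass.insBlind_of_reads`): a linear
age-weighted insertion reads its table only below the step, so two tables agreeing below the step insert the same history. -/
theorem insBlindB_of_readsB (h : LinearPair.ReadsB LB M W) : InsBlindB M W := by
  intro k g hg U t t' htt'
  rw [h k g hg U t, h k g hg U t', ← sub_eq_zero, LB.ins_sub_ins]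
  refine Finset.sum_eq_zero fun Y hY => ?_
  rw [htt' Y (LB.dom_lt k Y hY), sub_self, Complex.ofReal_zero, zero_smul]

/-- [folklore] **MI-R (L01 ∧ L02) BY CONSTRUCTION FOR THE LINEAR CLASS**: if both runs' insertions are read from linear classes and run A's
data are read at the transported background (`StepRecursion.ReadsTransported`), the recursively defined outputs satisfy
`RepresentsA (recA M) W ∧ RepresentsB (recB M) W` — no further hypothesis. -/
theorem represents_rec_of_linear (hA : LA.Reads M W) (hB : LinearPair.ReadsB LB M W) (hread : ReadsTransported M W) :
    M.RepresentsA (recA M) W ∧ M.RepresentsB (recB M) W :=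
  ⟨representsA_recA (LinearInsertion.insBlind_of_reads hA) hread, representsB_recB (insBlindB_of_readsB hB)⟩

end Summit.QuantumFields.BalabanUV.T4Continuum.InsertionLinearRateMIR
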